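import Mathlib
import Literature.Analysis.FluidPDE.Tao2016AveragedNS.BoundedEternalSolutions
import Summits.NavierStokesRegularity.NavierStokesRegularity.Theses.TaoLadderRungTwoBreak

/-!
# Crux `TaoLadderRungTwoBreak.NoSurvivingEternalViscBddOne` (stmt-NavierStokesRegularity-20419), stub (ρ0), DYADIC MEMBER in
# classical form: QUASI-STATIC SHELLS ARE QUASI-KOLMOGOROV (frozen triples balance) and the DSS PLATEAU LEMMA

MODEL lattice ODEs only (the non-negative Katz–Pavlović / Desnianskii–Novikov chain in Tao's critical variables,
`V̇_n = Λ V_{n-1}² − Λ⁻¹ V_n V_{n+1}` on `t < 0`, `Λ = (1+ε₀)^{5/2}`; tree `…WakeDyadicClassical` for the dictionary with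
admissible eternal solutions of `dyadicTable`); nothing in this file is a statement about the Navier–Stokes equations, and no
stub, crux, rung or summit is proved by it (`--supports stmt-NavierStokesRegularity-20419`).  DEF-FREE; companion of
`…WakeDyadicDSSTerminalDrift` (terminal drift `v_n²(Λ/κ² − κ/Λ)` of a DSS front; survivors overshoot), of
`…WakeDyadicKolmogorovEquilibrium` (exact equilibria are Kolmogorov) and of `…WakeDyadicLifetimeFeedDrain` (the identity
`v_n = Λ∫V_{n-1}² − Λ⁻¹∫V_nV_{n+1}`).

* §1 `le_sub_of_le_drive` / `sub_le_of_drive_le` — drive bounds integrate to increment bounds on a window `[t₁, t₂] ⊂ (−∞,0)`.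
* §2 `frozen_triple_balance_le` / `frozen_triple_balance_ge` — **QUASI-STATIC ⟹ QUASI-KOLMOGOROV**: if the shells `n−1, n, n+1`
  stay within relative `δ` of levels `p, q, r ≥ 0` on a window of length `ℓ`, then
  `ℓ·(Λ(1−δ)²p² − Λ⁻¹(1+δ)²qr) ≤ 2δq` and `ℓ·(Λ(1+δ)²p² − Λ⁻¹(1−δ)²qr) ≥ −2δq`: a frozen triple satisfies the Kolmogorov
  balance `Λp² = Λ⁻¹qr` up to `O(δ)` and `O(δq/ℓ)`; `static_triple_balance` is the exact case `δ = 0` (the local, windowed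
  form of the tree's equilibrium rigidity).
* §3 `dss_plateau_le` / `dss_plateau_ge` — **DSS PLATEAU LEMMA**: on a period-one DSS solution (`V_{n+1}(t) = κV_n(κt)`, `κ ≥ 1`)
  a single shell frozen within relative `δ` at level `q` on `[t₁, t₂]` freezes its neighbours on `[t₁/κ, κt₂]` at levels `q/κ`, `κq`
  (`dss_frozen_below`, `dss_frozen_above`), whence `(κt₂ − t₁/κ)·(Λ(1−δ)²(q/κ)² − Λ⁻¹(1+δ)²q·κq) ≤ 2δq` and the mirror bound:
  A LONG FLAT PLATEAU FORCES THE DRIFT FACTOR `Λ/κ² − κ/Λ` TO BE `O(δ)` — quantitatively how close to Kolmogorov (`κ³ = Λ²`)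
  a front with a quasi-static wake must be; in drift-factor form (`dss_survivor_plateau`):
  `ℓ·q·((1−δ)²κ/Λ − (1+δ)²Λ/κ²) ≤ 2δ`.  Read with `…DSSTerminalDrift.sq_lt_cube_of_threshold` (an (S₁)-survivor has
  `κ ≥ Λ^{4/5}`, so `κ/Λ − Λ/κ² ≥ Λ^{-1/5} − Λ^{-3/5} > 0`): THE WAKE OF A SURVIVING DSS FRONT DRAINS AT A DEFINITE RATE ON EVERY
  WINDOW — it is never quasi-static; the flatness `δ` of any window of DSS-length `ℓ` at level `q` is bounded below in terms of `ℓq`.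

READING for ⟨20419⟩/(ρ0), ⟨20205⟩ (census of this hand; memo `W1-DSS-identities-memo-leafhand4-g24.md` on both items): the missing
estimate of W1-dyadic on the DSS stratum is a quantitative post-firing decay / overshoot bound uniform as the base tends to one;
this file is the rigorous «flat ⟹ Kolmogorov» half of that dichotomy.  HONEST LABEL: elementary real analysis (mean-value
inequalities); W1-dyadic, (ρ0), ⟨20419⟩, ⟨20205⟩ and every NS statement remain OPEN; rung 0.
-/

-- the summit and its single sub-problem share the name (CONVENTIONS §1)
set_option linter.dupNamespace false

namespace Summit.NavierStokesRegularity.NavierStokesRegularity.Theorems.NoSurvivingEternalViscBddOne.QuasiStaticBalance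

open Filter Topology Set MeasureTheory
open Literature.Analysis.FluidPDE.TaoCascade

variable {ε₀ : ℝ} {V : ℤ → ℝ → ℝ}

/-! ## §1 Drive bounds integrate to increment bounds -/

/-- A LOWER bound `m` on the drive `ΛV_{n-1}² − Λ⁻¹V_nV_{n+1}` on a window `[t₁, t₂] ⊂ (−∞, 0)` gives
`m (t₂ − t₁) ≤ V_n(t₂) − V_n(t₁)`. [folklore] -/
theorem le_sub_of_le_drive
    (hV : ∀ (n : ℤ) (t : ℝ), t < 0 →
      HasDerivAt (V n) (bigLam ε₀ * V (n - 1) t ^ 2 - (bigLam ε₀)⁻¹ * (V n t * V (n + 1) t)) t)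
    (n : ℤ) {t₁ t₂ m : ℝ} (h12 : t₁ ≤ t₂) (ht₂ : t₂ < 0)
    (hm : ∀ t ∈ Icc t₁ t₂, m ≤ bigLam ε₀ * V (n - 1) t ^ 2 - (bigLam ε₀)⁻¹ * (V n t * V (n + 1) t)) :
    m * (t₂ - t₁) ≤ V n t₂ - V n t₁ := by
  have hcont : ContinuousOn (V n) (Icc t₁ t₂) :=
    fun t ht => (hV n t (lt_of_le_of_lt ht.2 ht₂)).continuousAt.continuousWithinAt
  have hdiff : DifferentiableOn ℝ (V n) (interior (Icc t₁ t₂)) := by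
    intro t ht
    rw [interior_Icc] at ht
    exact (hV n t (ht.2.trans ht₂)).differentiableAt.differentiableWithinAt
  have hge : ∀ t ∈ interior (Icc t₁ t₂), m ≤ deriv (V n) t := by
    intro t ht
    rw [interior_Icc] at ht
    rw [(hV n t (ht.2.trans ht₂)).deriv]
    exact hm t ⟨ht.1.le, ht.2.le⟩
  exact (convex_Icc t₁ t₂).mul_sub_le_image_sub_of_le_deriv hcont hdiff hge t₁ (left_mem_Icc.2 h12) t₂
    (right_mem_Icc.2 h12) h12

/-- An UPPER bound `M` on the drive on a window `[t₁, t₂] ⊂ (−∞, 0)` gives `V_n(t₂) − V_n(t₁) ≤ M (t₂ − t₁)`. [folklore] -/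
theorem sub_le_of_drive_le
    (hV : ∀ (n : ℤ) (t : ℝ), t < 0 →
      HasDerivAt (V n) (bigLam ε₀ * V (n - 1) t ^ 2 - (bigLam ε₀)⁻¹ * (V n t * V (n + 1) t)) t)
    (n : ℤ) {t₁ t₂ M : ℝ} (h12 : t₁ ≤ t₂) (ht₂ : t₂ < 0)
    (hM : ∀ t ∈ Icc t₁ t₂, bigLam ε₀ * V (n - 1) t ^ 2 - (bigLam ε₀)⁻¹ * (V n t * V (n + 1) t) ≤ M) :
    V n t₂ - V n t₁ ≤ M * (t₂ - t₁) := by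
  have hcont : ContinuousOn (V n) (Icc t₁ t₂) :=
    fun t ht => (hV n t (lt_of_le_of_lt ht.2 ht₂)).continuousAt.continuousWithinAt
  have hdiff : DifferentiableOn ℝ (V n) (interior (Icc t₁ t₂)) := by
    intro t ht
    rw [interior_Icc] at ht
    exact (hV n t (ht.2.trans ht₂)).differentiableAt.differentiableWithinAt
  have hle : ∀ t ∈ interior (Icc t₁ t₂), deriv (V n) t ≤ M := by
    intro t ht
    rw [interior_Icc] at ht
    rw [(hV n t (ht.2.trans ht₂)).deriv]
    exact hM t ⟨ht.1.le, ht.2.le⟩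
  exact (convex_Icc t₁ t₂).image_sub_le_mul_sub_of_deriv_le hcont hdiff hle t₁ (left_mem_Icc.2 h12) t₂
    (right_mem_Icc.2 h12) h12

/-! ## §2 Frozen triples are Kolmogorov-balanced up to `O(δ)` -/

/-- Lower bound on the drive of a frozen triple: `Λ(1−δ)²p² − Λ⁻¹(1+δ)²qr ≤ ΛV_{n-1}² − Λ⁻¹V_nV_{n+1}` when
`(1−δ)p ≤ V_{n-1}`, `0 ≤ V_n ≤ (1+δ)q`, `0 ≤ V_{n+1} ≤ (1+δ)r` (`0 ≤ δ ≤ 1`, `p ≥ 0`). [elementary] -/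
theorem drive_ge_of_frozen (hε : 0 < ε₀) {δ p q r a b c : ℝ} (hδ1 : δ ≤ 1) (hp : 0 ≤ p)
    (ha : (1 - δ) * p ≤ a) (hb0 : 0 ≤ b) (hb : b ≤ (1 + δ) * q) (hc0 : 0 ≤ c) (hc : c ≤ (1 + δ) * r) :
    bigLam ε₀ * ((1 - δ) ^ 2 * p ^ 2) - (bigLam ε₀)⁻¹ * ((1 + δ) ^ 2 * (q * r))
      ≤ bigLam ε₀ * a ^ 2 - (bigLam ε₀)⁻¹ * (b * c) := by
  have hΛ : 0 < bigLam ε₀ := bigLam_pos (by linarith)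
  have h1 : 0 ≤ (1 - δ) * p := mul_nonneg (by linarith) hp
  have hsq : ((1 - δ) * p) ^ 2 ≤ a ^ 2 := pow_le_pow_left₀ h1 ha 2
  have hprod : b * c ≤ (1 + δ) * q * ((1 + δ) * r) := mul_le_mul hb hc hc0 ((hb0.trans hb))
  have e1 : (1 - δ) ^ 2 * p ^ 2 = ((1 - δ) * p) ^ 2 := by ring
  have e2 : (1 + δ) ^ 2 * (q * r) = (1 + δ) * q * ((1 + δ) * r) := by ring
  rw [e1, e2]
  have hA : bigLam ε₀ * ((1 - δ) * p) ^ 2 ≤ bigLam ε₀ * a ^ 2 := mul_le_mul_of_nonneg_left hsq hΛ.le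
  have hB : (bigLam ε₀)⁻¹ * (b * c) ≤ (bigLam ε₀)⁻¹ * ((1 + δ) * q * ((1 + δ) * r)) :=
    mul_le_mul_of_nonneg_left hprod (inv_nonneg.2 hΛ.le)
  linarith

/-- Upper bound on the drive of a frozen triple: `ΛV_{n-1}² − Λ⁻¹V_nV_{n+1} ≤ Λ(1+δ)²p² − Λ⁻¹(1−δ)²qr` when
`0 ≤ V_{n-1} ≤ (1+δ)p`, `(1−δ)q ≤ V_n`, `(1−δ)r ≤ V_{n+1}` (`0 ≤ δ ≤ 1`, `q, r ≥ 0`). [elementary] -/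
theorem drive_le_of_frozen (hε : 0 < ε₀) {δ p q r a b c : ℝ} (hδ1 : δ ≤ 1) (hq : 0 ≤ q) (hr : 0 ≤ r)
    (ha0 : 0 ≤ a) (ha : a ≤ (1 + δ) * p) (hb : (1 - δ) * q ≤ b) (hc : (1 - δ) * r ≤ c) :
    bigLam ε₀ * a ^ 2 - (bigLam ε₀)⁻¹ * (b * c)
      ≤ bigLam ε₀ * ((1 + δ) ^ 2 * p ^ 2) - (bigLam ε₀)⁻¹ * ((1 - δ) ^ 2 * (q * r)) := by
  have hΛ : 0 < bigLam ε₀ := bigLam_pos (by linarith)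
  have hsq : a ^ 2 ≤ ((1 + δ) * p) ^ 2 := pow_le_pow_left₀ ha0 ha 2
  have hq1 : 0 ≤ (1 - δ) * q := mul_nonneg (by linarith) hq
  have hr1 : 0 ≤ (1 - δ) * r := mul_nonneg (by linarith) hr
  have hprod : (1 - δ) * q * ((1 - δ) * r) ≤ b * c := mul_le_mul hb hc hr1 (hq1.trans hb)
  have e1 : (1 + δ) ^ 2 * p ^ 2 = ((1 + δ) * p) ^ 2 := by ring
  have e2 : (1 - δ) ^ 2 * (q * r) = (1 - δ) * q * ((1 - δ) * r) := by ring
  rw [e1, e2]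
  have hA : bigLam ε₀ * a ^ 2 ≤ bigLam ε₀ * ((1 + δ) * p) ^ 2 := mul_le_mul_of_nonneg_left hsq hΛ.le
  have hB : (bigLam ε₀)⁻¹ * ((1 - δ) * q * ((1 - δ) * r)) ≤ (bigLam ε₀)⁻¹ * (b * c) :=
    mul_le_mul_of_nonneg_left hprod (inv_nonneg.2 hΛ.le)
  linarith

/-- **QUASI-STATIC ⟹ QUASI-KOLMOGOROV (feed side).**  If on a window `[t₁, t₂] ⊂ (−∞,0)` the shells `n−1, n, n+1` of a
non-negative solution stay within relative `δ ∈ [0,1]` of levels `p, q, r ≥ 0`, then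
`(t₂ − t₁)·(Λ(1−δ)²p² − Λ⁻¹(1+δ)²qr) ≤ 2δq`: a long frozen window forces the feed `Λp²` below the drain `Λ⁻¹qr` up to `O(δ)`.
[cite: Tao2016AveragedNS, §1.2, §4 Lemma 4.1 (4.8), §6.4 (the scalar chain in self-similar variables); elementary] -/
theorem frozen_triple_balance_le (hε : 0 < ε₀)
    (hV : ∀ (n : ℤ) (t : ℝ), t < 0 →
      HasDerivAt (V n) (bigLam ε₀ * V (n - 1) t ^ 2 - (bigLam ε₀)⁻¹ * (V n t * V (n + 1) t)) t)
    (hpos : ∀ (n : ℤ) (t : ℝ), t < 0 → 0 ≤ V n t)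
    (n : ℤ) {t₁ t₂ δ p q r : ℝ} (h12 : t₁ ≤ t₂) (ht₂ : t₂ < 0) (hδ1 : δ ≤ 1) (hp : 0 ≤ p)
    (hlo : ∀ t ∈ Icc t₁ t₂, (1 - δ) * p ≤ V (n - 1) t)
    (hq : ∀ t ∈ Icc t₁ t₂, (1 - δ) * q ≤ V n t ∧ V n t ≤ (1 + δ) * q)
    (hr : ∀ t ∈ Icc t₁ t₂, V (n + 1) t ≤ (1 + δ) * r) :
    (t₂ - t₁) * (bigLam ε₀ * ((1 - δ) ^ 2 * p ^ 2) - (bigLam ε₀)⁻¹ * ((1 + δ) ^ 2 * (q * r))) ≤ 2 * δ * q := by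
  have hm : ∀ t ∈ Icc t₁ t₂, bigLam ε₀ * ((1 - δ) ^ 2 * p ^ 2) - (bigLam ε₀)⁻¹ * ((1 + δ) ^ 2 * (q * r))
      ≤ bigLam ε₀ * V (n - 1) t ^ 2 - (bigLam ε₀)⁻¹ * (V n t * V (n + 1) t) := by
    intro t ht
    have ht0 : t < 0 := lt_of_le_of_lt ht.2 ht₂
    exact drive_ge_of_frozen hε hδ1 hp (hlo t ht) (hpos n t ht0) (hq t ht).2 (hpos (n + 1) t ht0) (hr t ht)
  have h := le_sub_of_le_drive hV n h12 ht₂ hm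
  have hinc : V n t₂ - V n t₁ ≤ 2 * δ * q := by
    have h2 := (hq t₂ (right_mem_Icc.2 h12)).2
    have h1 := (hq t₁ (left_mem_Icc.2 h12)).1
    linarith
  rw [mul_comm] at h
  linarith

/-- **QUASI-STATIC ⟹ QUASI-KOLMOGOROV (drain side).**  Under the mirror envelope hypotheses,
`−2δq ≤ (t₂ − t₁)·(Λ(1+δ)²p² − Λ⁻¹(1−δ)²qr)`: a long frozen window forces the drain below the feed up to `O(δ)`.
[cite: Tao2016AveragedNS, §1.2, §4 Lemma 4.1 (4.8), §6.4; elementary] -/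
theorem frozen_triple_balance_ge (hε : 0 < ε₀)
    (hV : ∀ (n : ℤ) (t : ℝ), t < 0 →
      HasDerivAt (V n) (bigLam ε₀ * V (n - 1) t ^ 2 - (bigLam ε₀)⁻¹ * (V n t * V (n + 1) t)) t)
    (hpos : ∀ (n : ℤ) (t : ℝ), t < 0 → 0 ≤ V n t)
    (n : ℤ) {t₁ t₂ δ p q r : ℝ} (h12 : t₁ ≤ t₂) (ht₂ : t₂ < 0) (hδ1 : δ ≤ 1) (hq0 : 0 ≤ q) (hr0 : 0 ≤ r)
    (hhi : ∀ t ∈ Icc t₁ t₂, V (n - 1) t ≤ (1 + δ) * p)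
    (hq : ∀ t ∈ Icc t₁ t₂, (1 - δ) * q ≤ V n t ∧ V n t ≤ (1 + δ) * q)
    (hr : ∀ t ∈ Icc t₁ t₂, (1 - δ) * r ≤ V (n + 1) t) :
    -(2 * δ * q) ≤ (t₂ - t₁) * (bigLam ε₀ * ((1 + δ) ^ 2 * p ^ 2) - (bigLam ε₀)⁻¹ * ((1 - δ) ^ 2 * (q * r))) := by
  have hM : ∀ t ∈ Icc t₁ t₂, bigLam ε₀ * V (n - 1) t ^ 2 - (bigLam ε₀)⁻¹ * (V n t * V (n + 1) t)
      ≤ bigLam ε₀ * ((1 + δ) ^ 2 * p ^ 2) - (bigLam ε₀)⁻¹ * ((1 - δ) ^ 2 * (q * r)) := by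
    intro t ht
    have ht0 : t < 0 := lt_of_le_of_lt ht.2 ht₂
    exact drive_le_of_frozen hε hδ1 hq0 hr0 (hpos (n - 1) t ht0) (hhi t ht) (hq t ht).1 (hr t ht)
  have h := sub_le_of_drive_le hV n h12 ht₂ hM
  have hinc : -(2 * δ * q) ≤ V n t₂ - V n t₁ := by
    have h2 := (hq t₂ (right_mem_Icc.2 h12)).1
    have h1 := (hq t₁ (left_mem_Icc.2 h12)).2
    linarith
  rw [mul_comm] at h
  linarith

/-- **Exactly static triples are exactly Kolmogorov-balanced**: if `V_{n-1} ≡ p`, `V_n ≡ q`, `V_{n+1} ≡ r` on a non-degenerate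
window `[t₁, t₂] ⊂ (−∞,0)`, then `Λp² = Λ⁻¹qr` (the local form of the tree's equilibrium rigidity).
[cite: Tao2016AveragedNS, §1.2, §4 (4.8); elementary] -/
theorem static_triple_balance (hε : 0 < ε₀)
    (hV : ∀ (n : ℤ) (t : ℝ), t < 0 →
      HasDerivAt (V n) (bigLam ε₀ * V (n - 1) t ^ 2 - (bigLam ε₀)⁻¹ * (V n t * V (n + 1) t)) t)
    (hpos : ∀ (n : ℤ) (t : ℝ), t < 0 → 0 ≤ V n t)
    (n : ℤ) {t₁ t₂ p q r : ℝ} (h12 : t₁ < t₂) (ht₂ : t₂ < 0)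
    (hp : ∀ t ∈ Icc t₁ t₂, V (n - 1) t = p) (hq : ∀ t ∈ Icc t₁ t₂, V n t = q)
    (hr : ∀ t ∈ Icc t₁ t₂, V (n + 1) t = r) :
    bigLam ε₀ * p ^ 2 = (bigLam ε₀)⁻¹ * (q * r) := by
  have ht₁ : t₁ < 0 := h12.trans ht₂
  have hp0 : 0 ≤ p := by rw [← hp t₁ (left_mem_Icc.2 h12.le)]; exact hpos _ _ ht₁
  have hq0 : 0 ≤ q := by rw [← hq t₁ (left_mem_Icc.2 h12.le)]; exact hpos _ _ ht₁
  have hr0 : 0 ≤ r := by rw [← hr t₁ (left_mem_Icc.2 h12.le)]; exact hpos _ _ ht₁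
  have hle := frozen_triple_balance_le (δ := 0) (p := p) (q := q) (r := r) hε hV hpos n h12.le ht₂ zero_le_one hp0
    (fun t ht => by rw [hp t ht]; linarith) (fun t ht => by rw [hq t ht]; constructor <;> linarith)
    (fun t ht => by rw [hr t ht]; linarith)
  have hge := frozen_triple_balance_ge (δ := 0) (p := p) (q := q) (r := r) hε hV hpos n h12.le ht₂ zero_le_one hq0 hr0
    (fun t ht => by rw [hp t ht]; linarith) (fun t ht => by rw [hq t ht]; constructor <;> linarith)
    (fun t ht => by rw [hr t ht]; linarith)
  simp only [sub_zero, add_zero, one_pow, one_mul, mul_zero, zero_mul, neg_zero] at hle hge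
  have hlen : 0 < t₂ - t₁ := sub_pos.2 h12
  have h1 : bigLam ε₀ * p ^ 2 - (bigLam ε₀)⁻¹ * (q * r) ≤ 0 := by
    by_contra hcon
    push Not at hcon
    have := mul_pos hlen hcon
    linarith
  have h2 : 0 ≤ bigLam ε₀ * p ^ 2 - (bigLam ε₀)⁻¹ * (q * r) := by
    by_contra hcon
    push Not at hcon
    have := mul_neg_of_pos_of_neg hlen hcon
    linarith
  linarith

/-! ## §3 The DSS plateau lemma -/

/-- On a period-one DSS solution (`V_{n+1}(t) = κV_n(κt)`, `κ ≥ 1`), a shell frozen within relative `δ` at level `q` on `[t₁,t₂]`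
freezes the shell BELOW at level `q/κ` on `[t₁/κ, κt₂]`. [elementary] -/
theorem dss_frozen_below {κ : ℝ} (hκ : 1 ≤ κ)
    (hdss : ∀ (n : ℤ) (t : ℝ), t < 0 → V (n + 1) t = κ * V n (κ * t))
    (n : ℤ) {t₁ t₂ δ q : ℝ} (ht₂ : t₂ < 0)
    (hq : ∀ t ∈ Icc t₁ t₂, (1 - δ) * q ≤ V n t ∧ V n t ≤ (1 + δ) * q)
    {t : ℝ} (ht : t ∈ Icc (t₁ / κ) (κ * t₂)) :
    (1 - δ) * (q / κ) ≤ V (n - 1) t ∧ V (n - 1) t ≤ (1 + δ) * (q / κ) := by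
  have hκ0 : 0 < κ := by linarith
  have ht0 : t < 0 := lt_of_le_of_lt ht.2 (by nlinarith)
  -- `V_n(t/κ) = κ V_{n-1}(t)`
  have hrel : V n (t / κ) = κ * V (n - 1) t := by
    have h := hdss (n - 1) (t / κ) (div_neg_of_neg_of_pos ht0 hκ0)
    rw [sub_add_cancel, mul_div_cancel₀ _ hκ0.ne'] at h
    exact h
  have hmem : t / κ ∈ Icc t₁ t₂ := by
    constructor
    · -- `t₁ ≤ t/κ` from `t₁/κ ≤ t` and `κ ≥ 1`, `t < 0`
      rw [le_div_iff₀ hκ0]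
      have h1 : t₁ ≤ t * κ := by
        have := ht.1; rwa [div_le_iff₀ hκ0] at this
      have h2 : t * κ ≤ t := by nlinarith
      have h3 : t₁ ≤ t := h1.trans h2
      have h4 : t₁ * κ ≤ t * κ := mul_le_mul_of_nonneg_right h3 hκ0.le
      exact h4.trans h2
    · rw [div_le_iff₀ hκ0]
      have h2 : t ≤ κ * t₂ := ht.2
      nlinarith
  obtain ⟨h1, h2⟩ := hq (t / κ) hmem
  rw [hrel] at h1 h2
  constructor
  · rw [show (1 - δ) * (q / κ) = ((1 - δ) * q) / κ by ring, div_le_iff₀ hκ0]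
    linarith
  · rw [show (1 + δ) * (q / κ) = ((1 + δ) * q) / κ by ring, le_div_iff₀ hκ0]
    linarith

/-- On a period-one DSS solution, a shell frozen within relative `δ` at level `q` on `[t₁,t₂]` freezes the shell ABOVE at level
`κq` on `[t₁/κ, κt₂]`. [elementary] -/
theorem dss_frozen_above {κ : ℝ} (hκ : 1 ≤ κ)
    (hdss : ∀ (n : ℤ) (t : ℝ), t < 0 → V (n + 1) t = κ * V n (κ * t))
    (n : ℤ) {t₁ t₂ δ q : ℝ} (ht₂ : t₂ < 0)
    (hq : ∀ t ∈ Icc t₁ t₂, (1 - δ) * q ≤ V n t ∧ V n t ≤ (1 + δ) * q)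
    {t : ℝ} (ht : t ∈ Icc (t₁ / κ) (κ * t₂)) :
    (1 - δ) * (κ * q) ≤ V (n + 1) t ∧ V (n + 1) t ≤ (1 + δ) * (κ * q) := by
  have hκ0 : 0 < κ := by linarith
  have ht0 : t < 0 := lt_of_le_of_lt ht.2 (by nlinarith)
  have hrel : V (n + 1) t = κ * V n (κ * t) := hdss n t ht0
  have hmem : κ * t ∈ Icc t₁ t₂ := by
    constructor
    · have h1 : t₁ / κ ≤ t := ht.1
      rw [div_le_iff₀ hκ0] at h1
      nlinarith
    · have h2 : t ≤ κ * t₂ := ht.2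
      nlinarith
  obtain ⟨h1, h2⟩ := hq (κ * t) hmem
  rw [hrel]
  constructor
  · rw [show (1 - δ) * (κ * q) = κ * ((1 - δ) * q) by ring]
    exact mul_le_mul_of_nonneg_left h1 hκ0.le
  · rw [show (1 + δ) * (κ * q) = κ * ((1 + δ) * q) by ring]
    exact mul_le_mul_of_nonneg_left h2 hκ0.le

/-- **DSS PLATEAU LEMMA (feed side).**  On a non-negative period-one DSS solution with `κ ≥ 1`, a single shell frozen within
relative `δ ∈ [0,1]` at level `q ≥ 0` on `[t₁,t₂] ⊂ (−∞,0)` with `t₁/κ ≤ κt₂` obeys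
`(κt₂ − t₁/κ) · (Λ(1−δ)²(q/κ)² − Λ⁻¹(1+δ)²(q·κq)) ≤ 2δq`: a long flat plateau forces `Λ/κ² ≲ κ/Λ` up to `O(δ)`.
[cite: Tao2016AveragedNS, §1.2, §4 Lemma 4.1 (4.8), §6.4; elementary] -/
theorem dss_plateau_le (hε : 0 < ε₀) {κ : ℝ} (hκ : 1 ≤ κ)
    (hV : ∀ (n : ℤ) (t : ℝ), t < 0 →
      HasDerivAt (V n) (bigLam ε₀ * V (n - 1) t ^ 2 - (bigLam ε₀)⁻¹ * (V n t * V (n + 1) t)) t)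
    (hpos : ∀ (n : ℤ) (t : ℝ), t < 0 → 0 ≤ V n t)
    (hdss : ∀ (n : ℤ) (t : ℝ), t < 0 → V (n + 1) t = κ * V n (κ * t))
    (n : ℤ) {t₁ t₂ δ q : ℝ} (hW : t₁ / κ ≤ κ * t₂) (ht₂ : t₂ < 0) (hδ1 : δ ≤ 1) (hq0 : 0 ≤ q)
    (hq : ∀ t ∈ Icc t₁ t₂, (1 - δ) * q ≤ V n t ∧ V n t ≤ (1 + δ) * q) :
    (κ * t₂ - t₁ / κ) * (bigLam ε₀ * ((1 - δ) ^ 2 * (q / κ) ^ 2)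
        - (bigLam ε₀)⁻¹ * ((1 + δ) ^ 2 * (q * (κ * q)))) ≤ 2 * δ * q := by
  have hκ0 : 0 < κ := by linarith
  have hκt₂ : κ * t₂ < 0 := by nlinarith
  have hsub : Icc (t₁ / κ) (κ * t₂) ⊆ Icc t₁ t₂ := by
    intro t ht
    constructor
    · have h1 := ht.1; rw [div_le_iff₀ hκ0] at h1
      have ht0 : t < 0 := lt_of_le_of_lt ht.2 hκt₂
      nlinarith
    · nlinarith [ht.2]
  exact frozen_triple_balance_le hε hV hpos n hW hκt₂ hδ1 (div_nonneg hq0 hκ0.le)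
    (fun t ht => (dss_frozen_below hκ hdss n ht₂ hq ht).1) (fun t ht => hq t (hsub ht))
    (fun t ht => (dss_frozen_above hκ hdss n ht₂ hq ht).2)

/-- **DSS PLATEAU LEMMA (drain side).**  Under the same hypotheses,
`−2δq ≤ (κt₂ − t₁/κ) · (Λ(1+δ)²(q/κ)² − Λ⁻¹(1−δ)²(q·κq))`: a long flat plateau forces `κ/Λ ≲ Λ/κ²` up to `O(δ)`.
Together: a flat stranded wake is born at the Kolmogorov ratio `κ³ = Λ²` up to `O(δ)` (compare
`…DSSTerminalDrift.dss_terminal_equilibrium_iff`, the case `δ = 0` at `t ↑ 0`).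
[cite: Tao2016AveragedNS, §1.2, §4 Lemma 4.1 (4.8), §6.4; elementary] -/
theorem dss_plateau_ge (hε : 0 < ε₀) {κ : ℝ} (hκ : 1 ≤ κ)
    (hV : ∀ (n : ℤ) (t : ℝ), t < 0 →
      HasDerivAt (V n) (bigLam ε₀ * V (n - 1) t ^ 2 - (bigLam ε₀)⁻¹ * (V n t * V (n + 1) t)) t)
    (hpos : ∀ (n : ℤ) (t : ℝ), t < 0 → 0 ≤ V n t)
    (hdss : ∀ (n : ℤ) (t : ℝ), t < 0 → V (n + 1) t = κ * V n (κ * t))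
    (n : ℤ) {t₁ t₂ δ q : ℝ} (hW : t₁ / κ ≤ κ * t₂) (ht₂ : t₂ < 0) (hδ1 : δ ≤ 1) (hq0 : 0 ≤ q)
    (hq : ∀ t ∈ Icc t₁ t₂, (1 - δ) * q ≤ V n t ∧ V n t ≤ (1 + δ) * q) :
    -(2 * δ * q) ≤ (κ * t₂ - t₁ / κ) * (bigLam ε₀ * ((1 + δ) ^ 2 * (q / κ) ^ 2)
        - (bigLam ε₀)⁻¹ * ((1 - δ) ^ 2 * (q * (κ * q)))) := by
  have hκ0 : 0 < κ := by linarith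
  have hκt₂ : κ * t₂ < 0 := by nlinarith
  have hsub : Icc (t₁ / κ) (κ * t₂) ⊆ Icc t₁ t₂ := by
    intro t ht
    constructor
    · have h1 := ht.1; rw [div_le_iff₀ hκ0] at h1
      have ht0 : t < 0 := lt_of_le_of_lt ht.2 hκt₂
      nlinarith
    · nlinarith [ht.2]
  exact frozen_triple_balance_ge hε hV hpos n hW hκt₂ hδ1 hq0 (mul_nonneg hκ0.le hq0)
    (fun t ht => (dss_frozen_below hκ hdss n ht₂ hq ht).2) (fun t ht => hq t (hsub ht))
    (fun t ht => (dss_frozen_above hκ hdss n ht₂ hq ht).1)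

/-- **SURVIVORS CANNOT REST: the plateau bound in drift-factor form.**  Normalising the plateau lemma by `q² > 0`:
on a δ-flat window of shell `n` (level `q`, DSS-length `ℓ = κt₂ − t₁/κ ≥ 0`),
`ℓ·q·((1−δ)²·(κ/Λ) − (1+δ)²·(Λ/κ²)) ≤ 2δ`.  For an (S₁)-survivor (`κ ≥ Λ^{4/5}`, `Λ > 1`, so `κ/Λ − Λ/κ² ≥ Λ^{-1/5} − Λ^{-3/5} > 0`
by `…DSSTerminalDrift.sq_lt_cube_of_threshold`) this bounds the flatness `δ` of every window of its wake from BELOW in terms of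
`ℓ·q`: the wake of a surviving DSS front drains at a definite rate on every window — it is never quasi-static.
[cite: Tao2016AveragedNS, §1.2, §4 Lemma 4.1 (4.8) and the viscous equation before Thm. 4.2, §6.4; elementary] -/
theorem dss_survivor_plateau (hε : 0 < ε₀) {κ : ℝ} (hκ : 1 ≤ κ)
    (hV : ∀ (n : ℤ) (t : ℝ), t < 0 →
      HasDerivAt (V n) (bigLam ε₀ * V (n - 1) t ^ 2 - (bigLam ε₀)⁻¹ * (V n t * V (n + 1) t)) t)
    (hpos : ∀ (n : ℤ) (t : ℝ), t < 0 → 0 ≤ V n t)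
    (hdss : ∀ (n : ℤ) (t : ℝ), t < 0 → V (n + 1) t = κ * V n (κ * t))
    (n : ℤ) {t₁ t₂ δ q : ℝ} (hW : t₁ / κ ≤ κ * t₂) (ht₂ : t₂ < 0) (hδ1 : δ ≤ 1) (hq0 : 0 < q)
    (hq : ∀ t ∈ Icc t₁ t₂, (1 - δ) * q ≤ V n t ∧ V n t ≤ (1 + δ) * q) :
    (κ * t₂ - t₁ / κ) * q * ((1 - δ) ^ 2 * (κ / bigLam ε₀) - (1 + δ) ^ 2 * (bigLam ε₀ / κ ^ 2)) ≤ 2 * δ := by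
  have hΛ : 0 < bigLam ε₀ := bigLam_pos (by linarith)
  have hκ0 : 0 < κ := by linarith
  have h := dss_plateau_ge hε hκ hV hpos hdss n hW ht₂ hδ1 hq0.le hq
  -- rewrite the bracket as `q² · (Λ(1+δ)²/κ² − (1−δ)²κ/Λ)`
  have e : bigLam ε₀ * ((1 + δ) ^ 2 * (q / κ) ^ 2) - (bigLam ε₀)⁻¹ * ((1 - δ) ^ 2 * (q * (κ * q)))
      = -(q * q * ((1 - δ) ^ 2 * (κ / bigLam ε₀) - (1 + δ) ^ 2 * (bigLam ε₀ / κ ^ 2))) := by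
    field_simp
    ring
  rw [e] at h
  have h' : (κ * t₂ - t₁ / κ) * (q * q * ((1 - δ) ^ 2 * (κ / bigLam ε₀) - (1 + δ) ^ 2 * (bigLam ε₀ / κ ^ 2)))
      ≤ 2 * δ * q := by linarith
  have h'' : q * ((κ * t₂ - t₁ / κ) * q * ((1 - δ) ^ 2 * (κ / bigLam ε₀) - (1 + δ) ^ 2 * (bigLam ε₀ / κ ^ 2)))
      ≤ q * (2 * δ) := by
    have : q * ((κ * t₂ - t₁ / κ) * q * ((1 - δ) ^ 2 * (κ / bigLam ε₀) - (1 + δ) ^ 2 * (bigLam ε₀ / κ ^ 2)))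
        = (κ * t₂ - t₁ / κ) * (q * q * ((1 - δ) ^ 2 * (κ / bigLam ε₀) - (1 + δ) ^ 2 * (bigLam ε₀ / κ ^ 2))) := by
      ring
    rw [this]; linarith
  exact le_of_mul_le_mul_left h'' hq0

end Summit.NavierStokesRegularity.NavierStokesRegularity.Theorems.NoSurvivingEternalViscBddOne.QuasiStaticBalance
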